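import Mathlib
import Literature.NumberTheory.Transcendental.KZCalculus
import Literature.NumberTheory.Transcendental.KZLogCalculusProofs
import Summits.KontsevichZagierPeriods.KontsevichZagierPeriods.Theorems.TorsionLogsNeronTorsionSectorStubHaarReps
import Summits.KontsevichZagierPeriods.KontsevichZagierPeriods.Theorems.TorsionLogsNeronTorsionSectorStubCellStepInst
import Summits.KontsevichZagierPeriods.KontsevichZagierPeriods.Theorems.TorsionLogsNeronTorsionSectorStubLowerRegular
import Summits.KontsevichZagierPeriods.KontsevichZagierPeriods.Theorems.TorsionLogsNeronTorsionSectorStubZeroStepInst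
import Summits.KontsevichZagierPeriods.KontsevichZagierPeriods.Theorems.TorsionLogsNeronTorsionSectorStubCellStepZeroInst
import Summits.KontsevichZagierPeriods.KontsevichZagierPeriods.Theorems.TorsionLogsNeronTorsionSectorStubWStepInst
import Summits.KontsevichZagierPeriods.KontsevichZagierPeriods.Theorems.TorsionLogsNeronTorsionSectorStubChartTransportInst
import Summits.KontsevichZagierPeriods.KontsevichZagierPeriods.Theorems.TorsionLogsNeronTorsionSectorStubLogA
import Summits.KontsevichZagierPeriods.KontsevichZagierPeriods.Theorems.TorsionLogsNeronTorsionSectorStubLogB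
import Summits.KontsevichZagierPeriods.KontsevichZagierPeriods.Theorems.TorsionLogsNeronTorsionSectorStubDlogUnfoldAux
import Summits.KontsevichZagierPeriods.KontsevichZagierPeriods.Theorems.TorsionLogsNeronTorsionSectorAssemblyRows
import Summits.KontsevichZagierPeriods.KontsevichZagierPeriods.Theorems.TorsionLogsNeronTorsionSectorAssemblyDecomp
import Summits.KontsevichZagierPeriods.KontsevichZagierPeriods.Theorems.TorsionLogsNeronTorsionSectorAssemblyObjects
import Summits.KontsevichZagierPeriods.KontsevichZagierPeriods.Theorems.TorsionLogsNeronTorsionSectorAssemblyColumns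
import Summits.KontsevichZagierPeriods.KontsevichZagierPeriods.Theorems.TorsionLogsNeronTorsionSectorAssemblyCorner
import Summits.KontsevichZagierPeriods.KontsevichZagierPeriods.Theorems.TorsionLogsNeronTorsionSectorAssemblyCornerUpper
import Summits.KontsevichZagierPeriods.KontsevichZagierPeriods.Theorems.TorsionLogsNeronTorsionSectorStubCornerChartLower
import HarnessLib

/-!
# Crux `TorsionLogs.NeronTorsionSector` (stmt-KontsevichZagierPeriods-14500) — assembly, the corner slice

Helper for the lead's stub `stub_assembly` (line `registered`): the part of the translation chain at the point at
infinity, in the chart `s = x^{-1/2}` (`asmCorner_lower/upper`): there are representations `t̂₀` (row-0 half-cell),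
`θ̂₀` and `θ̂_last` (row-0 third-kind reps of the two branches) such that, against the interface reps `t_1`, `c_1`,
`c_0`, `θ_1`, `ℓ(v)`: the up-step out of the corner `t_1 − t̂₀ − ℓ(q_1) + θ̂₀`, the first cell step
`c_1 − c_0 − ℓ(q_1) + ℓ(q_0)`, the corner step through infinity `2t̂₀ − c_0 − ℓ(q_0) + θ̂_last` are relations
(`stub_zeroStepInst`, `stub_cellStepZeroInst`, `stub_wStepInst`, `stub_chartTransportInst`, `asmCol_shift`), and
`θ_1 − θ̂₀`, `θ̂₀ − θ̂_last` are interval-log classes (`stub_logA`, `stub_logB`). [cite: KontsevichZagier2001, §1.2]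
-/

noncomputable section

open Set MeasureTheory Filter Topology
open Literature.NumberTheory.Transcendental Literature.NumberTheory.Transcendental.KZ
open Literature.ModelTheory.ExponentialFields
open Summit.KontsevichZagierPeriods.HyperbolicBloch.OffTetraSectorKernel (isSemialgebraic_logIvl exists_logRep)

-- `Summit.KontsevichZagierPeriods.KontsevichZagierPeriods.…` is the tree's mandated layout (single-conjunct summit).
set_option linter.dupNamespace false

namespace Summit.KontsevichZagierPeriods.KontsevichZagierPeriods.Cruxes.NeronTorsionSector.Translation

/-- **The corner slice** (see the module docstring). [cite: KontsevichZagier2001, §1.2] -/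
theorem asmS2_corner :
    ∀ (g₂ g₃ e₁ L₁ : ℝ) (m : ℕ) (x y : ℕ → ℝ) (f yb sl τ Y3 Qf sl3 X33 Y33 Qf3 Pg G τ' : ℝ → ℝ),
    (∀ t, f t = 4 * t ^ 3 - g₂ * t - g₃) → f e₁ = 0 → 0 < e₁ → (∀ t, e₁ < t → 0 < f t) →
    6 ≤ m → x m = e₁ →
    (∀ k, 1 ≤ k → k < m → e₁ < x k ∧ y k < 0) → (∀ k, 1 ≤ k → k < m → x (k + 1) < x k) →
    (∀ k, 1 ≤ k → k ≤ m → IsAlgebraic ℚ (x k)) →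
    (∀ k, 1 ≤ k → k < m → IsAlgebraic ℚ (y k) ∧ y k ^ 2 = f (x k)) →
    IsAlgebraic ℚ g₂ → IsAlgebraic ℚ g₃ →
    L₁ = (12 * x 1 ^ 2 - g₂) / (2 * y 1) → x 2 = L₁ ^ 2 / 4 - 2 * x 1 → y 2 = -(y 1 + L₁ * (x 2 - x 1)) →
    yb = (fun t => -Real.sqrt (f t)) →
    sl = (fun t => (4 * t ^ 2 + 4 * t * x 1 + 4 * x 1 ^ 2 - g₂) / (yb t + y 1)) →
    τ = (fun t => sl t ^ 2 / 4 - t - x 1) →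
    Y3 = (fun t => -(yb t + sl t * (τ t - t))) →
    Qf = (fun t => sl t / 2 + Y3 t / (2 * τ t) - yb t / (2 * t)) →
    sl3 = (fun t => (4 * τ t ^ 2 + 4 * τ t * x 1 + 4 * x 1 ^ 2 - g₂) / (Y3 t + y 1)) →
    X33 = (fun t => sl3 t ^ 2 / 4 - τ t - x 1) →
    Y33 = (fun t => -(Y3 t + sl3 t * (X33 t - τ t))) →
    Qf3 = (fun t => sl3 t / 2 + Y33 t / (2 * X33 t) - Y3 t / (2 * τ t)) →
    Pg = (fun t => 4 * (t + 2 * x 1) * y 1 - L₁ * (4 * t ^ 2 + 4 * t * x 1 + 4 * x 1 ^ 2 - g₂)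
      + 4 * (t + 2 * x 1) * yb t) →
    G = (fun t => Pg t / (yb t + y 1) ^ 2 * Real.sqrt (t * X33 t) / τ t) →
    τ' = (fun t => Y3 t / yb t) →
    MeasureTheory.IntegrableOn (fun t => (Real.sqrt (f t))⁻¹) (Set.Ioi e₁) →
    StrictMonoOn τ (Set.Ici (x 1)) → τ '' Set.Ioi (x 1) = Set.Ioo (x 2) (x 1) →
    (∀ k, 1 ≤ k → k + 2 ≤ m → StrictMonoOn τ (Set.Icc (x (k + 1)) (x k)) ∧
      τ '' Set.Ioo (x (k + 1)) (x k) = Set.Ioo (x (k + 2)) (x (k + 1)) ∧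
      τ (x k) = x (k + 1) ∧ τ (x (k + 1)) = x (k + 2)) →
    StrictAntiOn τ (Set.Icc e₁ (x (m - 1))) → τ '' Set.Ioo e₁ (x (m - 1)) = Set.Ioo e₁ (x (m - 1)) →
    τ e₁ = x (m - 1) → τ (x (m - 1)) = e₁ →
    ∀ (T1 C11 C10 : IntegralRep 2)
      (Θ1 : IntegralRep 1)
      (L1 : ℝ → IntegralRep 1),
    T1.domain = {z | x 2 < z 1 ∧ z 1 < z 0 ∧ z 0 < x 1} → Set.EqOn T1.integrand (fun z => (g₂ * z 1 + 2 * g₃) / (4 * (z 1) ^ 2) / (Real.sqrt (f (z 0)) * Real.sqrt (f (z 1)))) T1.domain →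
    C11.domain = {z | (x 2 < z 0 ∧ z 0 < x 1) ∧ x 2 < z 1 ∧ z 1 < x 1} → Set.EqOn C11.integrand (fun z => (g₂ * z 1 + 2 * g₃) / (4 * (z 1) ^ 2) / (Real.sqrt (f (z 0)) * Real.sqrt (f (z 1)))) C11.domain →
    C10.domain = {z | (x 2 < z 0 ∧ z 0 < x 1) ∧ x 1 < z 1} →
    Set.EqOn C10.integrand (fun z => (g₂ * z 1 + 2 * g₃) / (4 * (z 1) ^ 2) / (Real.sqrt (f (z 0)) * Real.sqrt (f (z 1)))) C10.domain →
    Θ1.domain = {t | x 2 < t 0 ∧ t 0 < x 1} →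
    Set.EqOn Θ1.integrand (fun t => Qf (t 0) / Real.sqrt (f (t 0))) Θ1.domain →
    (∀ v, IsAlgebraic ℚ v → (L1 v).domain = {t | x 2 < t 0 ∧ t 0 < x 1} ∧
      Set.EqOn (L1 v).integrand (fun t => v / Real.sqrt (f (t 0))) (L1 v).domain) →
    ∃ (T0 : IntegralRep 2)
      (Th0 Thl : IntegralRep 1),
      (of T1 - of T0 - of (L1 (Qf (x 1))) + of Th0 ∈ relations) ∧
      (of C11 - of C10 - of (L1 (Qf (x 1))) + of (L1 (y 1 / (2 * x 1))) ∈ relations) ∧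
      (2 • of T0 - of C10 - of (L1 (y 1 / (2 * x 1))) + of Thl ∈ relations) ∧
      (∃ (v : ℝ) (κ : ℕ) (α β : Fin κ → ℝ) (ε : Fin κ → ℤ)
        (cs : Fin κ → IntegralRep 1),
        (∀ i, 0 < α i ∧ α i ≤ β i ∧ IsAlgebraic ℚ (α i) ∧ IsAlgebraic ℚ (β i) ∧
          (cs i).domain = {t | α i < t 0 ∧ t 0 < β i} ∧
          Set.EqOn (cs i).integrand (fun t => 1 / t 0) (cs i).domain) ∧
        ∑ i, (ε i : ℝ) * Real.log (β i / α i) = v ∧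
        (of Θ1 - of Th0) - ∑ i, ε i • of (cs i) ∈
          relations) ∧
      (∃ (v : ℝ) (κ : ℕ) (α β : Fin κ → ℝ) (ε : Fin κ → ℤ)
        (cs : Fin κ → IntegralRep 1),
        (∀ i, 0 < α i ∧ α i ≤ β i ∧ IsAlgebraic ℚ (α i) ∧ IsAlgebraic ℚ (β i) ∧
          (cs i).domain = {t | α i < t 0 ∧ t 0 < β i} ∧
          Set.EqOn (cs i).integrand (fun t => 1 / t 0) (cs i).domain) ∧
        ∑ i, (ε i : ℝ) * Real.log (β i / α i) = v ∧
        (of Th0 - of Thl) - ∑ i, ε i • of (cs i) ∈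
          relations) := by
  intro g₂ g₃ e₁ L₁ m x y f yb sl τ Y3 Qf sl3 X33 Y33 Qf3 Pg G τ' hf he₁ he₁pos hfpos hm6 hxm hgLow hgDec hgAlg'
    hgAlgy ag₂ ag₃ hL₁ hx2 hy2 hyb hsl hτ hY3 hQf hsl3 hX33 hY33 hQf3 hPg hG hτ' hInt hτmono0 hτimg0 hτcell hτfanti hτfimg
    hτe₁ hτm1 T1 C11 C10 Θ1 L1 hT1d hT1i hC11d hC11i hC10d hC10i hΘ1d hΘ1i hL1
  have hx1 : e₁ < x 1 ∧ y 1 < 0 := hgLow 1 le_rfl (lt_of_lt_of_le (by norm_num) hm6)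
  have h1m : 1 < m := lt_of_lt_of_le (by norm_num) hm6
  have h2m : 2 < m := lt_of_lt_of_le (by norm_num) hm6
  have h3m : 3 < m := lt_of_lt_of_le (by norm_num) hm6
  have hmm : m ≤ m := le_rfl
  have hm1 : m - 1 + 1 = m := Nat.sub_add_cancel h1m.le
  have hm1lt : m - 1 < m := Nat.sub_lt (Nat.zero_lt_of_lt h1m) Nat.one_pos
  have h1m1 : 1 ≤ m - 1 := Nat.le_sub_one_of_lt h1m
  have hx1pos : 0 < x 1 := he₁pos.trans hx1.1
  have hx1alg : IsAlgebraic ℚ (x 1) := hgAlg' 1 le_rfl h1m.le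
  have hy1 : IsAlgebraic ℚ (y 1) ∧ y 1 ^ 2 = f (x 1) := hgAlgy 1 le_rfl h1m
  have hx2low : e₁ < x 2 ∧ y 2 < 0 := hgLow 2 (by norm_num) h2m
  have hx2pos : 0 < x 2 := he₁pos.trans hx2low.1
  have hx2alg : IsAlgebraic ℚ (x 2) := hgAlg' 2 (by norm_num) h2m.le
  have hx21 : x 2 < x 1 := hgDec 1 le_rfl h1m
  have he₁a : IsAlgebraic ℚ e₁ := by rw [← hxm]; exact hgAlg' m h1m.le hmm
  have hanti := asmDecomp_anti x m hgDec
  have hsanti := asmDecomp_strictAnti x m hgDec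
  obtain ⟨hτpos, -, -, hyby, hsemi, hrows, -⟩ := asmRows_package g₂ g₃ e₁ L₁ m x y f yb sl τ Y3 Qf sl3 X33 Y33 Qf3 Pg G
    τ' hf he₁ he₁pos hfpos hm6 hxm hgLow hgDec hgAlg' hy1.2 hy1.1 ag₂ ag₃ hL₁ hx2 hy2 hyb hsl hτ hY3 hQf hsl3 hX33 hY33 hQf3
    hPg hG hτ' hτmono0 hτimg0 hτcell hτfanti hτfimg hτe₁ hτm1
  -- the upper-branch formula functions and the chart parameter
  obtain ⟨ybp, hybp⟩ : ∃ g : ℝ → ℝ, g = fun t => Real.sqrt (f t) := ⟨_, rfl⟩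
  obtain ⟨slp, hslp⟩ : ∃ g : ℝ → ℝ, g = fun t => (4 * t ^ 2 + 4 * t * x 1 + 4 * x 1 ^ 2 - g₂) / (ybp t + y 1) := ⟨_, rfl⟩
  obtain ⟨τp, hτp⟩ : ∃ g : ℝ → ℝ, g = fun t => slp t ^ 2 / 4 - t - x 1 := ⟨_, rfl⟩
  obtain ⟨Y3p, hY3p⟩ : ∃ g : ℝ → ℝ, g = fun t => -(ybp t + slp t * (τp t - t)) := ⟨_, rfl⟩
  obtain ⟨Qfp, hQfp⟩ : ∃ g : ℝ → ℝ, g = fun t => slp t / 2 + Y3p t / (2 * τp t) - ybp t / (2 * t) := ⟨_, rfl⟩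
  obtain ⟨sl3p, hsl3p⟩ : ∃ g : ℝ → ℝ, g = fun t => (4 * τp t ^ 2 + 4 * τp t * x 1 + 4 * x 1 ^ 2 - g₂) / (Y3p t + y 1) := ⟨_, rfl⟩
  obtain ⟨X33p, hX33p⟩ : ∃ g : ℝ → ℝ, g = fun t => sl3p t ^ 2 / 4 - τp t - x 1 := ⟨_, rfl⟩
  obtain ⟨Y33p, hY33p⟩ : ∃ g : ℝ → ℝ, g = fun t => -(Y3p t + sl3p t * (X33p t - τp t)) := ⟨_, rfl⟩
  obtain ⟨Qf3p, hQf3p⟩ : ∃ g : ℝ → ℝ, g = fun t => sl3p t / 2 + Y33p t / (2 * X33p t) - Y3p t / (2 * τp t) := ⟨_, rfl⟩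
  obtain ⟨Pgp, hPgp⟩ : ∃ g : ℝ → ℝ, g = fun t => 4 * (t + 2 * x 1) * y 1 - L₁ * (4 * t ^ 2 + 4 * t * x 1 + 4 * x 1 ^ 2 - g₂)
      + 4 * (t + 2 * x 1) * ybp t := ⟨_, rfl⟩
  obtain ⟨Gp, hGp⟩ : ∃ g : ℝ → ℝ, g = fun t => Pgp t / (ybp t + y 1) ^ 2 * Real.sqrt (t * X33p t) / τp t := ⟨_, rfl⟩
  obtain ⟨τp', hτp'⟩ : ∃ g : ℝ → ℝ, g = fun t => Y3p t / ybp t := ⟨_, rfl⟩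
  set s₁ : ℝ := (Real.sqrt (x 1))⁻¹ with hs₁
  have hs₁pos : 0 < s₁ := by rw [hs₁]; exact inv_pos.mpr (Real.sqrt_pos.mpr hx1pos)
  have hs₁sq : s₁ ^ 2 * x 1 = 1 := by rw [hs₁, inv_pow, Real.sq_sqrt hx1pos.le, inv_mul_cancel₀ hx1pos.ne']
  have hs₁alg : IsAlgebraic ℚ s₁ := by
    rw [hs₁]; refine IsAlgebraic.inv_iff.mpr ?_
    have : IsAlgebraic ℚ (Real.sqrt (x 1) ^ 2) := by rw [Real.sq_sqrt hx1pos.le]; exact hx1alg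
    exact isAlgebraic_iff_isIntegral.mpr (IsIntegral.of_pow (n := 2) two_pos (isAlgebraic_iff_isIntegral.mp this))
  have hs₁inv : (s₁ ^ 2)⁻¹ = x 1 := by rw [eq_inv_of_mul_eq_one_left hs₁sq, inv_inv]
  -- the corner packages
  have hτ12 : ∀ t, x 2 ≤ t → t < x 1 → e₁ < τ t ∧ τ t < x 1 := by
    intro t ht1 ht2
    obtain ⟨hrange, -⟩ := hrows 1 le_rfl h3m.le
    obtain ⟨_, h2, _, _, h5⟩ := hrange t ⟨ht1, ht2.le⟩
    exact ⟨(hgLow 3 (by norm_num) h3m).1.trans_le h2, h5⟩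
  have hxm12 : x (m - 1) < x 2 := hsanti 2 (m - 1) (by norm_num) (Nat.lt_sub_of_add_lt h3m) hm1lt.le
  obtain ⟨R, τh, Qh, Gs, -, hchart, hRpos, hRc, hsR, -, hτh0, hQh0, -, hτhc, hsτh, hτhmaps, -, hQhc, hsQh, hGsc, hGsne, hsGs,
    hpt⟩ := asmCorner_lower g₂ g₃ e₁ (x 1) (y 1) (x 2) (y 2) L₁ (x (m - 1)) s₁ f yb sl τ Y3 Qf sl3 X33 Y33 Qf3 Pg G τ' hf he₁
    he₁pos hfpos hx1.1 hy1.2 hx1.2 hL₁ hx2 hy2 hx2low.1 hx21 hx2low.2 ag₂ ag₃ hx1alg hy1.1 hs₁pos hs₁sq hs₁alg hyb hsl hτ hY3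
    hQf hsl3 hX33 hY33 hQf3 hPg hG hτ' (hτcell 1 le_rfl h3m.le).2.2.1 hτimg0 hτ12 (hgLow (m - 1) h1m1 hm1lt).1.le hxm12 hτpos
  obtain ⟨σ, Qhp, Ghp, Mb, Sτh, Sτhanti, Sτhinj, Sτhimg, Sσ, Sσanti, Sσinj, Sσimg, hσc, hsσ, hσmaps, -, -, hagreeU, hQhp0,
    hQhpc, hsQhp, hQhpbd, hGhpc, hGhpne, hsGhp, hsQhσ, hxpt⟩ := asmCorner_upper g₂ g₃ e₁ (x 1) (y 1) (x 2) L₁ s₁ f yb sl τ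
    Y3 Qf τ' ybp slp τp Y3p Qfp sl3p X33p Y33p Qf3p Pgp Gp τp' R τh Qh hf he₁ he₁pos hfpos hx1.1 hy1.2 hx1.2 hL₁ hx2 hx2low.1
    hx21 ag₂ ag₃ hx1alg hy1.1 hs₁pos hs₁sq hs₁alg hyb hsl hτ hY3 hQf hybp hslp hτp hY3p hQfp hsl3p hX33p hY33p hQf3p hPgp
    hGp hτp' (hτcell 1 le_rfl h3m.le).2.2.1 hτimg0 hτmono0
    (fun t ht => ⟨(hpt t ht).2.2.2.2.1, (hpt t ht).2.2.2.2.2.1, (hpt t ht).2.2.2.2.2.2.1⟩)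
    (fun s hs0 hs => ⟨(hchart s hs0 hs).1, (hchart s hs0 hs).2.1, (hchart s hs0 hs).2.2.1⟩) hRpos hτh0 hsQh
  set τh' : ℝ → ℝ := fun s => τ' (s ^ 2)⁻¹ * (-2 / s ^ 3) with hτh'
  have Sτh' : ∀ s ∈ Set.Ioo 0 s₁, HasDerivAt τh (τh' s) s ∧ |τh' s| * R s = 2 * Real.sqrt (f (τh s)) ∧
      τh s ∈ Set.Ioo (x 2) (x 1) := fun s hs => ⟨(Sτh s hs).1, (Sτh s hs).2.2.1, (Sτh s hs).2.2.2⟩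
  have hchart3 : ∀ s, 0 < s → s ≤ s₁ →
      Real.sqrt (f (s ^ 2)⁻¹) = R s / s ^ 3 ∧ τh s = τ (s ^ 2)⁻¹ ∧ Qh s = Qf (s ^ 2)⁻¹ :=
    fun s hs0 hs => ⟨(hchart s hs0 hs).1, (hchart s hs0 hs).2.1, (hchart s hs0 hs).2.2.1⟩
  have hQhs₁ : Qh s₁ = Qf (x 1) := by rw [(hchart s₁ hs₁pos le_rfl).2.2.1, hs₁inv]
  have h0alg : IsAlgebraic ℚ (0:ℝ) := isAlgebraic_zero
  have hq1alg : IsAlgebraic ℚ (Qf (x 1)) := by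
    -- `Qf (x 1) = Qh s₁` is a field expression in algebraic numbers; simplest via the chart value at `0`:
    -- use semialgebraic-free route: `Qf(x1) = sl/2 + Y3/(2τ) − yb/(2x1)` with `yb (x 1) = y 1`
    have hdiv : ∀ {a b : ℝ}, IsAlgebraic ℚ a → IsAlgebraic ℚ b → IsAlgebraic ℚ (a / b) := fun ha hb => by
      rw [div_eq_mul_inv]; exact ha.mul (IsAlgebraic.inv_iff.mpr hb)
    have h4 : IsAlgebraic ℚ (4 : ℝ) := by simpa using isAlgebraic_algebraMap (R := ℚ) (A := ℝ) (4 : ℚ)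
    have h2 : IsAlgebraic ℚ (2 : ℝ) := by simpa using isAlgebraic_algebraMap (R := ℚ) (A := ℝ) (2 : ℚ)
    have hybk : IsAlgebraic ℚ (yb (x 1)) := by
      have : yb (x 1) = y 1 := by
        simp only [hyb]; rw [← hy1.2, Real.sqrt_sq_eq_abs, abs_of_neg hx1.2, neg_neg]
      rw [this]; exact hy1.1
    have hslk : IsAlgebraic ℚ (sl (x 1)) := by
      simp only [hsl]
      exact hdiv ((((h4.mul (hx1alg.pow 2)).add ((h4.mul hx1alg).mul hx1alg)).add (h4.mul (hx1alg.pow 2))).sub ag₂)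
        (hybk.add hy1.1)
    have hτk : IsAlgebraic ℚ (τ (x 1)) := by simp only [hτ]; exact ((hdiv (hslk.pow 2) h4).sub hx1alg).sub hx1alg
    have hY3k : IsAlgebraic ℚ (Y3 (x 1)) := by simp only [hY3]; exact (hybk.add (hslk.mul (hτk.sub hx1alg))).neg
    simp only [hQf]
    exact ((hdiv hslk h2).add (hdiv hY3k (h2.mul hτk))).sub (hdiv hybk (h2.mul hx1alg))
  have hq₀alg : IsAlgebraic ℚ (y 1 / (2 * x 1)) := by
    rw [div_eq_mul_inv]
    exact hy1.1.mul (IsAlgebraic.inv_iff.mpr ((by simpa using isAlgebraic_algebraMap (R := ℚ) (A := ℝ) (2 : ℚ) :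
      IsAlgebraic ℚ (2:ℝ)).mul hx1alg))
  /- the corner representations -/
  have hInt21 : IntegrableOn (fun t => (Real.sqrt (f t))⁻¹) (Set.Ioo (x 2) (x 1)) := hInt.mono_set fun t ht => hx2low.1.trans ht.1
  obtain ⟨B00, Cmix, hB00d, hB00i, hCmixd, hCmixi⟩ := asmObj_exists_chart_reps2 g₂ g₃ e₁ (x 2) (x 1) s₁ f R hf ag₂ ag₃ hx2alg
    hx1alg hs₁alg hs₁pos hx2low.1.le hfpos hInt21 hRc hRpos hsR
  obtain ⟨T0', T0, hT0'd, hT0'i, hT0d, hT0i, hBsplit⟩ := asmObj_square_split h0alg hs₁alg B00 hB00d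
  obtain ⟨hchart1, hchart2⟩ := asmObj_exists_chart_reps1 s₁ R hs₁alg hs₁pos hRc hRpos hsR
  have hIcc0σ : IsSemialgebraic ℚ {p : Fin 1 → ℝ | p 0 ∈ Set.Icc (0:ℝ) s₁} := cornerLower_isSemialgebraic_slab h0alg hs₁alg
  have hIoo0σ : IsSemialgebraic ℚ {p : Fin 1 → ℝ | p 0 ∈ Set.Ioo (0:ℝ) s₁} := isSemialgebraic_logIvl h0alg hs₁alg
  obtain ⟨Th0, hTh0d, hTh0i⟩ := hchart1 Qh hQhc hsQh
  obtain ⟨rOz, hrOzd, hrOzi⟩ := hchart1 (fun s => Qh s₁ - Qh s) (continuousOn_const.sub hQhc)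
    (IsSemialgebraicFunOn.sub_holds (isSemialgebraicFunOn_const_of_isAlgebraic hIcc0σ (by rw [hQhs₁]; exact hq1alg)) hsQh)
  obtain ⟨Lh1, hLh1d, hLh1i⟩ := hchart1 (fun _ => Qh s₁) continuousOn_const
    (isSemialgebraicFunOn_const_of_isAlgebraic hIcc0σ (by rw [hQhs₁]; exact hq1alg))
  obtain ⟨Lh0, hLh0d, hLh0i⟩ := hchart1 (fun _ => Qhp 0) continuousOn_const
    (isSemialgebraicFunOn_const_of_isAlgebraic hIcc0σ (by rw [hQhp0]; exact hq₀alg))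
  have hsQhp' : IsSemialgebraicFunOn ℚ {p : Fin 1 → ℝ | p 0 ∈ Set.Ioo (0:ℝ) s₁} (fun p => Qhp (p 0)) :=
    hsQhp.mono (fun p (hp : p 0 ∈ Set.Ioo (0:ℝ) s₁) => Ioo_subset_Ico_self hp) hIoo0σ
  obtain ⟨Thl, hThld, hThli⟩ := hchart2 Qhp Mb hQhpbd hsQhp'
  obtain ⟨rOw, hrOwd, hrOwi⟩ := hchart2 (fun s => Qhp 0 - Qhp s) (|Qhp 0| + Mb)
    (fun s hs => by have h1 := abs_sub (Qhp 0) (Qhp s); have h2 := hQhpbd s hs; linarith)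
    (IsSemialgebraicFunOn.sub_holds (isSemialgebraicFunOn_const_of_isAlgebraic hIoo0σ (by rw [hQhp0]; exact hq₀alg)) hsQhp')
  -- the corner cell in the x-chart and its shift to `C10`
  set Cb : ℝ := |g₂| / (4 * e₁) + |g₃| / (2 * e₁ ^ 2) with hCb
  have hCbd : ∀ t, e₁ < t → |(g₂ * t + 2 * g₃) / (4 * t ^ 2)| ≤ Cb := by
    intro t ht
    have ht0 : 0 < t := he₁pos.trans ht
    rw [abs_div, abs_of_pos (by positivity : (0:ℝ) < 4 * t ^ 2), hCb]
    calc |g₂ * t + 2 * g₃| / (4 * t ^ 2) ≤ (|g₂| * t + 2 * |g₃|) / (4 * t ^ 2) := by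
            gcongr
            calc |g₂ * t + 2 * g₃| ≤ |g₂ * t| + |2 * g₃| := abs_add_le _ _
              _ = |g₂| * t + 2 * |g₃| := by rw [abs_mul, abs_mul, abs_of_pos ht0, abs_two]
      _ = |g₂| / (4 * t) + |g₃| / (2 * t ^ 2) := by field_simp; ring
      _ ≤ |g₂| / (4 * e₁) + |g₃| / (2 * e₁ ^ 2) := by gcongr
  have hIoiσ : IsSemialgebraic ℚ {p : Fin 1 → ℝ | p 0 ∈ Set.Ioi e₁} := isSemialgebraic_setOf_const_lt_apply he₁a 0
  have hIoi1σ : IsSemialgebraic ℚ {p : Fin 1 → ℝ | p 0 ∈ Set.Ioi (x 1)} := isSemialgebraic_setOf_const_lt_apply hx1alg 0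
  obtain ⟨C00, hC00d, hC00i⟩ := stub_haarReps.2 g₂ g₃ e₁ Cb f (fun t => (g₂ * t + 2 * g₃) / (4 * t ^ 2)) (Set.Ioi e₁)
    {z | x 1 < z 0 ∧ x 1 < z 1} ag₂ ag₃ he₁a hf hfpos hInt subset_rfl hIoiσ
    (cellStep_isSemialgebraicFunOn_kernel hIoiσ ag₂ ag₃ fun p hp => (he₁pos.trans hp).ne')
    (ContinuousOn.div (by fun_prop) (by fun_prop) fun t ht => by have : 0 < t := he₁pos.trans ht; positivity)
    (fun t ht => hCbd t ht) (asmObj_isSemialgebraic_quadrant hx1alg) (fun z hz => ⟨hx1.1.trans hz.1, hx1.1.trans hz.2⟩)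
  have hC00_C10 : of C00 - of C10 ∈ relations :=
    asmCol_shift g₂ g₃ f τ τ' (Set.Ioi (x 1)) (Set.Ioo (x 2) (x 1)) (Set.Ioi (x 1)) C00 C10 hIoi1σ (hsemi _ hIoi1σ).1
      (hτmono0.injOn.mono Set.Ioi_subset_Ici_self) hτimg0 (fun t ht => by
        obtain ⟨_, _, _, _, hd, _, hhaar, _, _, hlo, _⟩ := hpt t (le_of_lt ht)
        exact ⟨hd, hhaar, hfpos t (hx1.1.trans ht), hfpos _ (hx2low.1.trans_le hlo)⟩)
      (by rw [hC00d]; rfl) (by rw [hC10d]; rfl) (fun z _ => by rw [hC00i]) hC10i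
  /- the steps -/
  obtain ⟨-, -, -, L4, -, -, -⟩ := stub_lowerRegular g₂ g₃ e₁ (x 1) (y 1) (x 2) (y 2) L₁ (x (m - 1)) f yb sl τ Y3 Qf sl3 X33 Y33
    Qf3 Pg G τ' hf he₁ he₁pos hfpos hx1.1 hy1.2 hx1.2 hL₁ hx2 hy2 hx2low.1 hx2low.2 ag₂ ag₃ hx1alg hy1.1 hyb hsl hτ hY3 hQf hsl3
    hX33 hY33 hQf3 hPg hG hτ'
  have hQfd0 : ∀ t, x 1 < t → HasDerivAt Qf
      (((g₂ * τ t + 2 * g₃) / (4 * τ t ^ 2) - (g₂ * t + 2 * g₃) / (4 * t ^ 2)) / (-Real.sqrt (f t))) t := by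
    intro t ht
    have := L4.2.2.2 t (hx1.1.trans ht) (hx2pos.trans_le (hpt t ht.le).2.2.2.2.2.2.2.2.2.1).ne'
    simp only [hyb] at this; exact this
  have hQfpd : ∀ t, x 1 < t → HasDerivAt Qfp
      (((g₂ * τp t + 2 * g₃) / (4 * τp t ^ 2) - (g₂ * t + 2 * g₃) / (4 * t ^ 2)) / Real.sqrt (f t)) t := by
    intro t ht; have := (hxpt t ht).2.2.2.2.1; simp only [hybp] at this; exact this
  have hCbd2 : ∀ t, x 2 ≤ t → |(g₂ * t + 2 * g₃) / (4 * t ^ 2)| ≤ Cb := fun t ht => hCbd t (hx2low.1.trans_le ht)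
  have hT0i' : Set.EqOn T0.integrand
      (fun z => (g₂ * (z 1) ^ 2 + 2 * g₃ * (z 1) ^ 4) / 4 * (2 / R (z 0)) * (2 / R (z 1))) T0.domain := fun z _ => by rw [hT0i, hB00i]
  have hT0'i' : Set.EqOn T0'.integrand
      (fun z => (g₂ * (z 1) ^ 2 + 2 * g₃ * (z 1) ^ 4) / 4 * (2 / R (z 0)) * (2 / R (z 1))) T0'.domain := fun z _ => by rw [hT0'i, hB00i]
  have hq10alg : IsAlgebraic ℚ (Qh s₁ - Qh 0) := by rw [hQhs₁, hQh0]; exact hq1alg.sub hq₀alg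
  have A0 : of T1 - of T0 - of rOz ∈ relations :=
    stub_zeroStepInst g₂ g₃ (x 1) (x 2) s₁ Cb f τ Qf R τh τh' Qh T0 T1 rOz hf ag₂ ag₃ hx1alg hx2alg hs₁alg hx2pos hx21 hs₁pos hs₁sq
      (fun t ht => hfpos t (hx2low.1.trans_le ht)) hCbd2 hchart3 hRpos hRc hsR Sτh' Sτhanti Sτhinj Sτhimg hsτh hQhc hsQh hQfd0 hT0d
      hT0i' hT1d hT1i hrOzd (fun t _ => by rw [hrOzi])
  have AC : of C11 - of Cmix - of (L1 (Qh s₁ - Qh 0)) ∈ relations :=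
    stub_cellStepZeroInst g₂ g₃ e₁ (x 2) (x 1) (x 1) (x 2) s₁ Cb f τ Qf R τh τh' Qh Cmix C11 (L1 (Qh s₁ - Qh 0)) hf ag₂ ag₃ hx2alg
      hx1alg hx1alg hx2alg hs₁alg he₁pos hx2low.1 hx21 hx2low.1 hx21 hs₁pos hs₁sq hfpos hCbd hInt21 hchart3 hRpos hRc hsR Sτh'
      Sτhinj Sτhimg hsτh hQhc hsQh hQfd0 hCmixd (fun z _ => by rw [hCmixi]) hC11d hC11i (hL1 _ hq10alg).1 (hL1 _ hq10alg).2
  have AW : of T0 - of T0' - of rOw ∈ relations :=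
    stub_wStepInst g₂ g₃ (x 1) s₁ f τp Qfp R σ Qhp T0' T0 rOw hf ag₂ ag₃ hx1alg hs₁alg hx1pos hs₁pos hs₁sq
      (fun t ht => hfpos t (hx1.1.trans_le ht)) (fun s hs0 hs => (hchart s hs0 hs).1) hRpos hRc hsR Sσ Sσanti Sσinj Sσimg hsσ
      (fun s hs0 hs => ⟨(hagreeU s hs0 hs).1, (hagreeU s hs0 hs).2.1⟩) hQhpc hsQhp hQfpd hT0'd hT0'i' hT0d hT0i' hrOwd
      (fun t _ => by rw [hrOwi])
  have ATr : of C10 - of Cmix ∈ relations ∧ of C00 - of B00 ∈ relations :=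
    stub_chartTransportInst g₂ g₃ e₁ (x 2) (x 1) (x 1) s₁ Cb f R Cmix C10 B00 C00 hf ag₂ ag₃ hx2alg hx1alg hx1alg hs₁alg he₁pos
      hx2low.1 hx21 hx1.1 hs₁pos hs₁sq hfpos hCbd hInt21 (fun s hs0 hs => (hchart s hs0 hs).1) hRpos hRc hsR hCmixd
      (fun z _ => by rw [hCmixi]) hC10d hC10i hB00d (fun z _ => by rw [hB00i]) hC00d (fun z _ => by rw [hC00i])
  -- integrand splits and the chart transport of the constants
  have hsplit1 : ∀ (r r₁ r₂ : IntegralRep 1), r₁.domain = r.domain → r₂.domain = r.domain →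
      Set.EqOn r.integrand (r₁.integrand + r₂.integrand) r.domain → of r - of r₁ - of r₂ ∈ relations :=
    fun r r₁ r₂ h1 h2 h3 => KZ.integrandAddRel_subset_relations ⟨1, r, r₁, r₂, h1, h2, h3, rfl⟩
  have Bz : of Lh1 - of rOz - of Th0 ∈ relations := hsplit1 _ _ _ (by rw [hrOzd, hLh1d]) (by rw [hTh0d, hLh1d]) fun t _ => by
    rw [Pi.add_apply, hLh1i, hrOzi, hTh0i]; ring
  have Bw : of Lh0 - of rOw - of Thl ∈ relations := hsplit1 _ _ _ (by rw [hrOwd, hLh0d]) (by rw [hThld, hLh0d]) fun t _ => by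
    rw [Pi.add_apply, hLh0i, hrOwi, hThli]; ring
  have hLh_toL1 : ∀ (Lh : IntegralRep 1) (v : ℝ), IsAlgebraic ℚ v → Lh.domain = {t | 0 < t 0 ∧ t 0 < s₁} →
      (Lh.integrand = fun t => v * (2 / R (t 0))) → of Lh - of (L1 v) ∈ relations := by
    intro Lh v hv hd hi
    obtain ⟨hd', hi'⟩ := hL1 v hv
    refine of_sub_of_mem_relations_of_cov_fin_one (G := τh) (G' := τh') (I := Set.Ioo 0 s₁) _ _ (by rw [hd]; rfl)
      (by rw [hd]; exact hsτh.mono (fun p (hp : p 0 ∈ Set.Ioo (0:ℝ) s₁) => Ioo_subset_Icc_self hp) hIoo0σ)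
      (fun s hs => (Sτh s hs).1) Sτhinj (by rw [hd', Sτhimg]; rfl) fun t ht => ?_
    rw [hd] at ht
    obtain ⟨_, _, hhaar, hmem⟩ := Sτh (t 0) ht
    have hR : 0 < R (t 0) := hRpos _ (Ioo_subset_Icc_self ht)
    have hfτ : 0 < Real.sqrt (f (τh (t 0))) := Real.sqrt_pos.2 (hfpos _ (hx2low.1.trans hmem.1))
    rw [hi, hi' (by rw [hd']; exact hmem)]
    show v * (2 / R (t 0)) = v / Real.sqrt (f (τh (t 0))) * |τh' (t 0)|
    have : |τh' (t 0)| = 2 * Real.sqrt (f (τh (t 0))) / R (t 0) := by rw [eq_div_iff hR.ne']; exact hhaar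
    rw [this, div_mul_div_comm, show v * (2 * Real.sqrt (f (τh (t 0)))) = v * 2 * Real.sqrt (f (τh (t 0))) by ring,
      mul_comm (Real.sqrt (f (τh (t 0)))) (R (t 0)), mul_div_mul_right _ _ hfτ.ne']
    ring
  have Cz := hLh_toL1 Lh1 (Qh s₁) (by rw [hQhs₁]; exact hq1alg) hLh1d hLh1i
  have Cw := hLh_toL1 Lh0 (Qhp 0) (by rw [hQhp0]; exact hq₀alg) hLh0d hLh0i
  rw [hQhs₁] at Cz
  rw [hQhp0] at Cw
  have hq0' : Qh 0 = y 1 / (2 * x 1) := hQh0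
  -- `ℓ(a − b) ≡ ℓ(a) − ℓ(b)`
  have D : of (L1 (Qf (x 1))) - of (L1 (Qh s₁ - Qh 0)) - of (L1 (y 1 / (2 * x 1))) ∈ relations := by
    obtain ⟨hd, hi⟩ := hL1 _ hq1alg
    obtain ⟨hdm, him⟩ := hL1 _ hq10alg
    obtain ⟨hd0, hi0⟩ := hL1 _ hq₀alg
    refine hsplit1 _ _ _ (by rw [hdm, hd]) (by rw [hd0, hd]) fun t ht => ?_
    rw [Pi.add_apply, hi ht, him (by rw [hdm, ← hd]; exact ht), hi0 (by rw [hd0, ← hd]; exact ht), hQhs₁, hq0']; ring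
  refine ⟨T0, Th0, Thl, ?_, ?_, ?_, ?_, ?_⟩
  · rw [show of T1 - of T0 - of (L1 (Qf (x 1))) + of Th0 =
      (of T1 - of T0 - of rOz) - (of Lh1 - of rOz - of Th0) + (of Lh1 - of (L1 (Qf (x 1)))) by abel]
    exact relations.add_mem (relations.sub_mem A0 Bz) Cz
  · rw [show of C11 - of C10 - of (L1 (Qf (x 1))) + of (L1 (y 1 / (2 * x 1))) =
      (of C11 - of Cmix - of (L1 (Qh s₁ - Qh 0))) - (of C10 - of Cmix)
      - (of (L1 (Qf (x 1))) - of (L1 (Qh s₁ - Qh 0)) - of (L1 (y 1 / (2 * x 1)))) by abel]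
    exact relations.sub_mem (relations.sub_mem AC ATr.1) D
  · rw [show 2 • of T0 - of C10 - of (L1 (y 1 / (2 * x 1))) + of Thl =
      (of T0 - of T0' - of rOw) - (of Lh0 - of rOw - of Thl) + (of Lh0 - of (L1 (y 1 / (2 * x 1))))
      - (of B00 - of T0' - of T0) - (of C00 - of B00) + (of C00 - of C10) by rw [two_nsmul]; abel]
    exact relations.add_mem (relations.sub_mem (relations.sub_mem (relations.add_mem (relations.sub_mem AW Bw) Cw) hBsplit) ATr.2) hC00_C10
  · exact ⟨_, stub_logA g₂ g₃ (x 1) (x 2) s₁ f yb τ Qf G R τh τh' Qh Gs Θ1 Th0 hf ag₂ ag₃ hx1alg hx2alg hs₁alg hx2pos hx21 hs₁pos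
      hs₁sq (fun t ht => hfpos t (hx2low.1.trans_le ht)) hyb
      (fun s hs0 hs => ⟨(hchart s hs0 hs).1, (hchart s hs0 hs).2.1, (hchart s hs0 hs).2.2.1, (hchart s hs0 hs).2.2.2.1⟩)
      hRpos hRc hsR Sτh Sτhinj Sτhimg hτhc hτhmaps hsτh (hrows 1 le_rfl h3m.le).2.2.1
      (hsemi _ (cornerLower_isSemialgebraic_slab hx2alg hx1alg)).2.1
      (asmCorner_semialg_comp hIcc0σ (hsemi _ (cornerLower_isSemialgebraic_slab hx2alg hx1alg)).2.1 hsτh hτhmaps) hQhc hsQh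
      (fun t ht => (hpt t ht.le).2.2.2.2.2.2.2.2.1) hGsc hGsne hsGs hΘ1d hΘ1i hTh0d (fun t _ => by rw [hTh0i])⟩
  · exact ⟨_, stub_logB g₂ g₃ (x 1) s₁ Mb f ybp τp Qf Qfp Gp R σ Qh Qhp Ghp Th0 Thl hf ag₂ ag₃ hx1alg hs₁alg hx1pos hs₁pos hs₁sq
      (fun t ht => hfpos t (hx1.1.trans_le ht)) hybp (fun s hs0 hs => (hchart s hs0 hs).1)
      (fun s hs0 hs => ⟨(hagreeU s hs0 hs).2.2.1, (hagreeU s hs0 hs).1, (hagreeU s hs0 hs).2.2.2.1⟩) hRpos hRc hsR Sσ Sσinj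
      Sσimg hσc hσmaps hsσ hQhc hsQh hsQhσ hQhpbd hsQhp' (fun t ht => (hxpt t ht).2.2.2.2.2.2) hGhpc hGhpne hsGhp hTh0d
      (fun t _ => by rw [hTh0i]) hThld (fun t _ => by rw [hThli])⟩

end Summit.KontsevichZagierPeriods.KontsevichZagierPeriods.Cruxes.NeronTorsionSector.Translation
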